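import Mathlib
import Literature.Computability.AlgebraicComplexity.Apolarity
import Literature.Computability.AlgebraicComplexity.ApolarityAction

/-!
# Border apolarity, crux `ToricWitnessObstructionQP` (stmt-ValiantsHypothesis-14753) — line `Sketch`,
# reshape 4: helper `initialForm_apolar_topComponent` (lowest-weight initial forms annihilate the
# top weight component)

Route `ValiantsHypothesis/BorderApolarity`, crux item `stmt-ValiantsHypothesis-14753`, line `Sketch`,
reshape 4, wave-2 helper stub `initialForm_apolar_topComponent` (the algebraic fact W5 used in the
converse direction "data ⇒ witness").

Fix integer weights `w : σ → ℤ` and write `f_{(m)} := weightedHomogeneousComponent w m f`.  If every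
monomial of `F` has `w`-weight `≤ e` (so `F_{(e)}` is the top component), `E ⌟ F = 0`
(`apolarAction E F = 0`) and all components `E_{(ν')}`, `ν' < ν`, vanish (so `E_{(ν)}` is the lowest,
"initial", component), then `E_{(ν)} ⌟ F_{(e)} = 0`.

Proof (coefficientwise).  `(D ⌟ f)_u = Σ_{e' ∈ supp D} D_{e'} f_{u+e'} c(u+e', e')`
(`ifat_coeff_apolarAction`).  For `D = E_{(ν)}`, `f = F_{(e)}` a term survives only if
`wt e' = ν` and `wt (u + e') = e`, forcing `wt u = e - ν`; for such `u` the same sum for `E ⌟ F`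
(which vanishes) has no other terms: `wt e' < ν` kills `E_{e'}`, and `wt e' > ν` gives
`wt (u + e') > e`, killing `F_{u+e'}`.
-/

open MvPolynomial Filter
open scoped BigOperators Matrix
open Literature.Computability.AlgebraicComplexity

-- the mandated summit-side namespace repeats a component by design (single-problem summit)
set_option linter.dupNamespace false

namespace Summit.ValiantsHypothesis.ValiantsHypothesis.Theorems.BorderApolarityToricWitnessObstructionQP

/-- Coefficients of the apolarity action: `(D ⌟ f)_u = Σ_{e ∈ supp D} D_e f_{u+e} ∏ᵢ (u+e)ᵢ!/(uᵢ)!`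
(only `d = u + e` contributes to `x^u`, the terms with `e ≰ d` vanish). [folklore] -/
theorem ifat_coeff_apolarAction {σ : Type*} {k : Type*} [CommRing k] (D f : MvPolynomial σ k)
    (u : σ →₀ ℕ) :
    coeff u (apolarAction D f) =
      ∑ e ∈ D.support, coeff e D * coeff (u + e) f *
        ∏ i ∈ e.support, (Nat.descFactorial ((u + e) i) (e i) : k) := by
  classical
  rw [apolarAction_def, coeff_sum]
  refine Finset.sum_congr rfl fun e _ => ?_
  rw [coeff_sum]
  simp only [coeff_monomial]
  rw [Finset.sum_eq_single (u + e)]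
  · rw [if_pos (add_tsub_cancel_right u e)]
  · intro d _ hne
    split_ifs with h
    · -- `d - e = u` but `d ≠ u + e` forces `e ≰ d`, and then a descending factorial vanishes
      have hle : ¬ e ≤ d := fun hle => hne (by rw [← tsub_add_cancel_of_le hle, h])
      obtain ⟨i, hi⟩ : ∃ i, d i < e i := by
        simpa only [Finsupp.le_def, not_forall, not_le] using hle
      have hie : i ∈ e.support := Finsupp.mem_support_iff.2 (by omega)
      have hzero : (Nat.descFactorial (d i) (e i) : k) = 0 := by
        rw [Nat.descFactorial_eq_zero_iff_lt.2 hi, Nat.cast_zero]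
      rw [Finset.prod_eq_zero hie hzero, mul_zero]
    · rfl
  · intro hn
    rw [if_pos (add_tsub_cancel_right u e), notMem_support_iff.1 hn, mul_zero, zero_mul]

/-- The coefficient formula for `D ⌟ f` summed over any finite set of exponents containing
`supp D`. [folklore] -/
theorem ifat_coeff_apolarAction_of_subset {σ : Type*} {k : Type*} [CommRing k]
    (D f : MvPolynomial σ k) (u : σ →₀ ℕ) {S : Finset (σ →₀ ℕ)} (hS : D.support ⊆ S) :
    coeff u (apolarAction D f) =
      ∑ e ∈ S, coeff e D * coeff (u + e) f *
        ∏ i ∈ e.support, (Nat.descFactorial ((u + e) i) (e i) : k) := by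
  rw [ifat_coeff_apolarAction]
  apply Finset.sum_subset hS
  intro e _ he
  rw [notMem_support_iff.1 he, zero_mul, zero_mul]

/-- H1 (wave 2 helper): lowest-weight initial forms of annihilators annihilate the top weight
component. [folklore] -/
theorem initialForm_apolar_topComponent : ∀ {σ : Type} [Fintype σ] [DecidableEq σ] (w : σ → ℤ)
    (F E : MvPolynomial σ ℂ) (e ν : ℤ),
    (∀ d ∈ F.support, Finsupp.weight w d ≤ e) → apolarAction E F = 0 →
    (∀ ν' : ℤ, ν' < ν → weightedHomogeneousComponent w ν' E = 0) →
    apolarAction (weightedHomogeneousComponent w ν E) (weightedHomogeneousComponent w e F) = 0 := by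
  intro σ _ _ w F E e ν hF hEF hE
  ext u
  have hsub : (weightedHomogeneousComponent w ν E).support ⊆ E.support := by
    rw [support_weightedHomogeneousComponent]
    exact Finset.filter_subset _ _
  rw [coeff_zero, ifat_coeff_apolarAction_of_subset _ _ u hsub]
  by_cases hu : Finsupp.weight w u = e - ν
  · -- the weight-`(e - ν)` coefficients are those of `E ⌟ F = 0`
    have h0 : coeff u (apolarAction E F) = 0 := by rw [hEF, coeff_zero]
    rw [ifat_coeff_apolarAction] at h0
    rw [← h0]
    refine Finset.sum_congr rfl fun e' _ => ?_
    rw [coeff_weightedHomogeneousComponent, coeff_weightedHomogeneousComponent]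
    rcases lt_trichotomy (Finsupp.weight w e') ν with hlt | heq | hgt
    · -- below the initial weight: `E_{e'} = 0`
      have hzero : coeff e' E = 0 := by
        have := congrArg (coeff e') (hE _ hlt)
        rwa [coeff_weightedHomogeneousComponent, if_pos rfl, coeff_zero] at this
      simp [hzero]
    · have hue : Finsupp.weight w (u + e') = e := by
        rw [map_add, hu, heq]
        ring
      rw [if_pos heq, if_pos hue]
    · -- above the initial weight: `u + e'` is above the top weight of `F`
      have hzero : coeff (u + e') F = 0 := by
        rw [← notMem_support_iff]
        intro hmem
        have := hF _ hmem
        rw [map_add, hu] at this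
        omega
      simp [hzero]
  · -- off weight `e - ν` every term vanishes
    refine Finset.sum_eq_zero fun e' _ => ?_
    rw [coeff_weightedHomogeneousComponent, coeff_weightedHomogeneousComponent]
    split_ifs with h1 h2
    · exfalso
      apply hu
      rw [map_add] at h2
      omega
    all_goals simp

end Summit.ValiantsHypothesis.ValiantsHypothesis.Theorems.BorderApolarityToricWitnessObstructionQP
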